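import Summits.QuantumFields.YangMills.Theorems.LangevinControlUVOSLegsFromFemtoAndGapStubAssemblyPlaneStrings
import HarnessLib

/-!
# Soft OS-assembly toolkit XV-a: the density distribution as the sum of the plane-string distributions

Helper file for stub `stub_assembly6` of crux `OSLegsFromFemtoAndGap` (stmt-QuantumFields-9367, line
`dlr-collar-transfer`, reshape r2): the canonical centred density weight is the sum of the `6ⁿ` plane-string
weights (`torusMoment_dens_eq_sum_torusMomentStr`, toolkit IX at the level of moments) and hence the density
distribution is the sum of the plane-string distributions (`latticeDist_dens_eq_sum_latticeDistStr`).
-/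

noncomputable section

open scoped SchwartzMap BigOperators
open MeasureTheory Filter Topology
open Literature.MathematicalPhysics.QuantumFieldTheory Literature.MathematicalPhysics.QuantumLattice
open Literature.MathematicalPhysics.AQFT
open Literature.Probability.LatticeModels (box Site)
open Summit.QuantumFields.YangMills.Cruxes.OSLegsFromFemtoAndGap.DlrCollarTransfer (torusE dens plane)

namespace Summit.QuantumFields.YangMills.Theorems.OSLegsFromFemtoAndGap

/-- The set of valid plane strings of length `n`. -/
theorem mem_planeStrings_iff {n : ℕ} (q : Fin n → Fin 4 × Fin 4) :
    q ∈ Fintype.piFinset (fun _ : Fin n => Finset.univ.filter fun p : Fin 4 × Fin 4 => p.1 < p.2) ↔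
      ∀ i, (q i).1 < (q i).2 := by
  simp [Fintype.mem_piFinset]

variable {G : Type} [Group G] [TopologicalSpace G] [IsTopologicalGroup G] [CompactSpace G]
  [MeasurableSpace G] [BorelSpace G]

/-- **The canonical centred density weight is the sum of the `6ⁿ` plane-string weights.** -/
theorem torusMoment_dens_eq_sum_torusMomentStr (r : LatticeRep G) (β : ℝ) (L : ℕ) {n : ℕ} (x : Fin n → Site 4) :
    torusMoment r.ρ β L r.curvature.F (wilsonTorusMean r.ρ β L r.curvature.F) x =
      ∑ q ∈ Fintype.piFinset (fun _ : Fin n => Finset.univ.filter fun p : Fin 4 × Fin 4 => p.1 < p.2),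
        torusMomentStr r.ρ β L (fun i U => plaquetteObs r.ρ 0 (q i).1 (q i).2 U)
          (fun i => wilsonTorusMean r.ρ β L (fun U => plaquetteObs r.ρ 0 (q i).1 (q i).2 U)) x := by
  classical
  rw [← torusE_prod_eq_torusMoment]
  simp_rw [← torusE_prod_plane_eq_torusMomentStr]
  have hexp : ∀ U : GaugeConfig 4 (2 * L + 1) G,
      ∏ i, (dens G r (x i) (torusLift (2 * L + 1) U) - torusE G r β L (dens G r (x i))) =
        ∑ q ∈ Fintype.piFinset (fun _ : Fin n => Finset.univ.filter fun p : Fin 4 × Fin 4 => p.1 < p.2),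
          ∏ i, (plane G r (q i) (x i) (torusLift (2 * L + 1) U) - torusE G r β L (plane G r (q i) (x i))) := by
    intro U
    simp_rw [dens_sub_torusE_eq_sum r β L]
    rw [Finset.prod_univ_sum]
  unfold torusE
  rw [← integral_finsetSum _ (fun q _ => integrable_prod_plane_sub r β L q x _)]
  exact integral_congr_ae (Eventually.of_forall fun U => hexp U)

/-- **The canonical density distribution is the sum of the `6ⁿ` plane-string distributions.** -/
theorem latticeDist_dens_eq_sum_latticeDistStr (r : LatticeRep G) (β : ℝ) (L : ℕ) (s : ℝ) (n : ℕ)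
    (F : 𝓢((Fin n → EuclideanSpace ℝ (Fin 4)), ℂ)) :
    latticeDist r.ρ β L s r.curvature.F (wilsonTorusMean r.ρ β L r.curvature.F) n F =
      ∑ q ∈ Fintype.piFinset (fun _ : Fin n => Finset.univ.filter fun p : Fin 4 × Fin 4 => p.1 < p.2),
        latticeDistStr r.ρ β L s (fun i U => plaquetteObs r.ρ 0 (q i).1 (q i).2 U)
          (fun i => wilsonTorusMean r.ρ β L (fun U => plaquetteObs r.ρ 0 (q i).1 (q i).2 U)) F := by
  rw [latticeDist_apply]
  simp_rw [latticeDistStr_apply]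
  rw [Finset.sum_comm]
  refine Finset.sum_congr rfl fun x _ => ?_
  rw [torusMoment_dens_eq_sum_torusMomentStr, ← Finset.sum_mul]
  push_cast
  rfl

end Summit.QuantumFields.YangMills.Theorems.OSLegsFromFemtoAndGap

end
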